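import Mathlib

/-!
# Sketch — crux idea `kronecker-bits` (planner cruxidea 21438 k1 g26)

First checkable statements of the line, over Mathlib only (the tree has no typed
Eisenstein–Kronecker numbers `E₁(z; L)` yet; those enter as the abstract function `E` below).

* `resolvent_reindex` — the exact "coboundary = resolvent" identity behind CHECK3 / law (A):
  for an orbit function `E : G → R`, a character `ε`, and the α-smoothing
  `G_α(c) = a • E(α c) - N • E(c)` one has `Σ_c ε(c)⁻¹ G_α(c) = (a ε(α) - N) Σ_c ε(c)⁻¹ E(c)`.
* `LevelZeroKroneckerLaw` — the abstract level-0 law: with an odd orbit function `E`, an even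
  character `χ` and an odd auxiliary character `κ ≡ 1 (mod P)`, the half-orbit functional
  `Σ_{c ∈ Rset} χ(c)⁻¹ G_α(c)` (k1g25's `f(α)`) is congruent mod `P` to
  `(a χ(α) κ(α)⁻¹ - N) · S`, `S = Σ_{c ∈ Rset} χ(c)⁻¹ κ(c) E(c)` the full-orbit resolvent of the odd
  character `χ κ⁻¹` (well defined: the summand is invariant under `c ↦ m c`).
-/

namespace Summit.BirchSwinnertonDyer.BirchSwinnertonDyer.Cruxes.SignedMuSeedAtTwoPlus.KroneckerBits

open Finset BigOperators

/-- Exact reindexing identity (CHECK3 of exp/cwbit.gp; de Shalit II.3.1 (5),(7) supply the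
closed form `G_α = a•E(α·) − N•E` with `a = α`, `N = Nα` for `E = E₁(·Ω/f₀; Ω𝒪_K)`). -/
theorem resolvent_reindex {G R : Type*} [CommGroup G] [Fintype G] [CommRing R]
    (E : G → R) (ε : G →* Rˣ) (α : G) (a N : R) :
    ∑ c, ((ε c)⁻¹ : Rˣ).val * (a * E (α * c) - N * E c)
      = (a * (ε α).val - N) * ∑ c, ((ε c)⁻¹ : Rˣ).val * E c := by
  classical
  have h1 : ∑ c, ((ε c)⁻¹ : Rˣ).val * E (α * c)
      = (ε α).val * ∑ c, ((ε c)⁻¹ : Rˣ).val * E c := by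
    rw [Finset.mul_sum]
    refine Fintype.sum_equiv (Equiv.mulLeft α) _ _ ?_
    intro c
    simp only [Equiv.coe_mulLeft, map_mul, mul_inv_rev, Units.val_mul]
    have hu : (ε α).val * ((ε α)⁻¹ : Rˣ).val = 1 := by
      rw [← Units.val_mul, mul_inv_cancel, Units.val_one]
    calc ((ε c)⁻¹ : Rˣ).val * E (α * c)
        = ((ε α).val * ((ε α)⁻¹ : Rˣ).val) * (((ε c)⁻¹ : Rˣ).val * E (α * c)) := by
          rw [hu, one_mul]
      _ = (ε α).val * (((ε c)⁻¹ : Rˣ).val * ((ε α)⁻¹ : Rˣ).val * E (α * c)) := by ring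
  have h2 : ∑ c, ((ε c)⁻¹ : Rˣ).val * (a * E (α * c) - N * E c)
      = a * ∑ c, ((ε c)⁻¹ : Rˣ).val * E (α * c) - N * ∑ c, ((ε c)⁻¹ : Rˣ).val * E c := by
    rw [Finset.mul_sum, Finset.mul_sum, ← Finset.sum_sub_distrib]
    refine Finset.sum_congr rfl ?_
    intro c _
    ring
  rw [h2, h1]
  ring

/-- The abstract LEVEL-0 KRONECKER LAW (first lemma of the line; informal T0 with
`E c = E₁(cΩ/f₀; Ω𝒪_K)`, `G = (𝒪_K/f₀)ˣ`, `m = -1`, `P = 𝔓 ∩ (ring of values)`, `χ = χ₀^e`,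
`κ` an odd character of 2-power order, `Gα c = (d/dz) log ψ_α (x(P_c))`):
if `E` is odd, `χ` even, `κ` odd with `κ c - 1 ∈ P`, and `Gα = a•E(α·) − N•E` on `G`, then for every
set of representatives `Rset` of `G` modulo `m` the half-orbit functional is congruent to
`(a χ(α) κ(α)⁻¹ − N) · S(χ κ⁻¹)` modulo `P`. -/
def LevelZeroKroneckerLaw : Prop :=
  ∀ (G R : Type) [CommGroup G] [Fintype G] [DecidableEq G] [CommRing R]
    (P : Ideal R) (m : G) (E Gα : G → R) (χ κ : G →* Rˣ) (α : G) (a N : R) (Rset : Finset G),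
    m * m = 1 → m ≠ 1 →
    (∀ c, E (m * c) = - E c) →                      -- E odd
    χ m = 1 → κ m = -1 → (∀ c, (κ c).val - 1 ∈ P) →  -- χ even, κ odd, κ ≡ 1 mod P
    (∀ c, Gα c = a * E (α * c) - N * E c) →          -- closed form (de Shalit II.3.1)
    (∀ c, (c ∈ Rset ∧ m * c ∉ Rset) ∨ (c ∉ Rset ∧ m * c ∈ Rset)) →   -- representatives mod ⟨m⟩
    (∑ c ∈ Rset, ((χ c)⁻¹ : Rˣ).val * Gα c)
      - (a * (χ α).val * ((κ α)⁻¹ : Rˣ).val - N)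
        * (∑ c ∈ Rset, ((χ c)⁻¹ : Rˣ).val * (κ c).val * E c) ∈ P

end Summit.BirchSwinnertonDyer.BirchSwinnertonDyer.Cruxes.SignedMuSeedAtTwoPlus.KroneckerBits
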